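import Summits.ValiantsHypothesis.ValiantsHypothesis.Theorems.BarrierLeverTransversalMinorLayoutsRankSevenCells

/-!
# Route BarrierLever — conjecture TT (`TransversalMinorLayoutsNonsingular`, stmt-ValiantsHypothesis-19152):
# TT for layouts with at most SEVEN rows, every height

Helper file (`--supports stmt-ValiantsHypothesis-19152`; cell valiant-natproofs, rung V4, 𝒟-side of
door (c); seat val-np-p1 gen 8).  The bounded locked-complex engine
(`FiniteCheck.tt_rank_le_of_lockedCore`, `…FiniteCheck`) reduces TT for `r ≤ 7` rows to LOCKED
pairs of complexes with `r ≤ 7` faces at heights `h < r`; `r ≤ 6` is `…RankSix`, `h ≤ 3` is the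
tree's `PPSmall.transversalMinorLayouts_nonsingular_of_le_three`, and a locked pair has a side using
every coordinate, so three cells remain.  `(6, 7)` and `(5, 7)` are `…RankSevenCells`; here:

* `degree_of_claw_two_edges` / `good_twoEdges_h4` (cell `(4, 7)`): the full side is the `4`-claw
  plus two edges (`image_eq_of_claw_two_edges`).  If the edges share a vertex, degrees `1, 2, 3`
  all occur on that side while the other side has a vertex of degree between `1` and `3` — not
  locked.  If they are disjoint (a perfect MATCHING, all degrees `2`) the other side has no vertex
  of degree two and is a TRIANGLE (`lowerFamily_seven_no_degree_two`); the kernel certificate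
  `matching_v_triangle_h4_derivable` transports.
* `transversalMinorLayouts_nonsingular_of_r_le_seven`: **item 19152's conclusion for every
  injective layout pair with `r ≤ 7` rows, at every height** — prover gen 8's finite-check claim
  «TT(r ≤ 7, all h)» (HUB-MEMO-g8 §3) as a kernel theorem, here via R1/R2 + four priority-peeling
  certificates instead of hub words.

WHAT THIS IS NOT: a bounded-rank slice of TT (seven rows, any number of coordinates); nothing on
TT / item 19761 in general, on crux stmt-ValiantsHypothesis-14610, or on `VP` versus `VNP`.
-/

-- layout Summits/ValiantsHypothesis/ValiantsHypothesis forces the duplicated namespace component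
set_option linter.dupNamespace false

open Matrix Finset

namespace Summit.ValiantsHypothesis.ValiantsHypothesis.Theorems.BarrierLever.FiniteCheck

open Summit.ValiantsHypothesis.ValiantsHypothesis.Theorems.BarrierLever.Compression
open Summit.ValiantsHypothesis.ValiantsHypothesis.Theorems.BarrierLever.PriorityPeeling

/-! ## 1. Degrees in a claw with two edges -/

/-- In a complex whose faces are `∅`, the singletons and two distinct pairs `e₁`, `e₂`, the
coordinate `x` lies in `[x ∈ e₁] + [x ∈ e₂] + 1` faces. -/
theorem degree_of_claw_two_edges {h r : ℕ} (u : Fin r → Finset (Fin h))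
    (hu : Function.Injective u) (e₁ e₂ : Finset (Fin h)) (hne : e₁ ≠ e₂) (h1 : e₁.card = 2)
    (h2 : e₂.card = 2)
    (himg : Finset.univ.image u = insert e₁ (insert e₂
      (insert (∅ : Finset (Fin h)) (Finset.univ.image fun a : Fin h => ({a} : Finset (Fin h))))))
    (x : Fin h) :
    (Finset.univ.filter fun i => x ∈ u i).card =
      (if x ∈ e₁ then 1 else 0) + (if x ∈ e₂ then 1 else 0) + 1 := by
  classical
  have e : ((Finset.univ.image u).filter fun y => x ∈ y).card =
      (Finset.univ.filter fun i => x ∈ u i).card := by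
    rw [Finset.filter_image, Finset.card_image_of_injective _ hu]
  rw [← e, himg]
  have hS : (insert (∅ : Finset (Fin h))
      (Finset.univ.image fun a : Fin h => ({a} : Finset (Fin h)))).filter (fun y => x ∈ y) =
      {{x}} := by
    ext t
    simp only [Finset.mem_filter, Finset.mem_insert, Finset.mem_image, Finset.mem_univ, true_and,
      Finset.mem_singleton]
    constructor
    · rintro ⟨ht, hxt⟩
      rcases ht with rfl | ⟨a, rfl⟩
      · simp at hxt
      · rw [Finset.mem_singleton] at hxt; rw [hxt]
    · rintro rfl
      exact ⟨Or.inr ⟨x, rfl⟩, Finset.mem_singleton_self x⟩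
  have hx1 : e₁ ≠ {x} := fun e => by
    have := congrArg Finset.card e; rw [h1, Finset.card_singleton] at this; omega
  have hx2 : e₂ ≠ {x} := fun e => by
    have := congrArg Finset.card e; rw [h2, Finset.card_singleton] at this; omega
  rw [Finset.filter_insert, Finset.filter_insert, hS]
  have n1 : e₁ ∉ ({{x}} : Finset (Finset (Fin h))) := by rwa [Finset.mem_singleton]
  have n2 : e₂ ∉ ({{x}} : Finset (Finset (Fin h))) := by rwa [Finset.mem_singleton]
  have n12 : e₁ ∉ (insert e₂ {{x}} : Finset (Finset (Fin h))) := by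
    rw [Finset.mem_insert, Finset.mem_singleton, not_or]; exact ⟨hne, hx1⟩
  by_cases hm1 : x ∈ e₁ <;> by_cases hm2 : x ∈ e₂ <;> simp only [hm1, hm2, if_true, if_false]
  · rw [Finset.card_insert_of_notMem n12, Finset.card_insert_of_notMem n2, Finset.card_singleton]
  · rw [Finset.card_insert_of_notMem n1, Finset.card_singleton]
  · rw [Finset.card_insert_of_notMem n2, Finset.card_singleton]
  · rw [Finset.card_singleton]

/-! ## 2. Cell (4, 7): two edges against a triangle -/

/-- **Cell `(4, 7)`.**  A complex `u` with seven faces using all four coordinates, against a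
seven-face complex `w` none of whose degrees equals a degree of `u`, is GOOD: `u` is a perfect
matching and `w` a triangle. -/
theorem good_twoEdges_h4 (u w : Fin 7 → Finset (Fin 4)) (hu : Function.Injective u)
    (hw : Function.Injective w) (hlu : IsLowerSet (Set.range u)) (hlw : IsLowerSet (Set.range w))
    (hfull : ∀ a : Fin 4, ∃ i, a ∈ u i)
    (hclash : ∀ (a c : Fin 4), (Finset.univ.filter fun i => a ∈ u i).card ≠
      (Finset.univ.filter fun j => c ∈ w j).card) :
    ∃ H : Matrix (Fin (4 + 4)) (Fin (4 + 4)) ℂ, (Matrix.of fun i j : Fin 7 => (H.submatrix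
      (fun a : Fin 4 => if a ∈ u i then Fin.castAdd 4 a else Fin.natAdd 4 a)
      (fun c : Fin 4 => if c ∈ w j then Fin.natAdd 4 c else Fin.castAdd 4 c)).det).det ≠ 0 := by
  classical
  obtain ⟨e₁, e₂, hne, h1, h2, himg⟩ := image_eq_of_claw_two_edges u hu hlu hfull rfl (by norm_num)
  have hdegu := degree_of_claw_two_edges u hu e₁ e₂ hne h1 h2 himg
  obtain ⟨hlow, hcard, hdegeq⟩ := image_lowerFamily w hw hlw
  by_cases hdisj : Disjoint e₁ e₂
  · -- a perfect matching against a triangle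
    obtain ⟨p, q, hpq, rfl⟩ := Finset.card_eq_two.mp h1
    obtain ⟨s, t, hst, rfl⟩ := Finset.card_eq_two.mp h2
    have hps : p ≠ s := fun e => Finset.disjoint_left.mp hdisj
      (show p ∈ ({p, q} : Finset (Fin 4)) by simp) (show p ∈ ({s, t} : Finset (Fin 4)) by simp [e])
    have hpt : p ≠ t := fun e => Finset.disjoint_left.mp hdisj
      (show p ∈ ({p, q} : Finset (Fin 4)) by simp) (show p ∈ ({s, t} : Finset (Fin 4)) by simp [e])
    have hqs : q ≠ s := fun e => Finset.disjoint_left.mp hdisj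
      (show q ∈ ({p, q} : Finset (Fin 4)) by simp) (show q ∈ ({s, t} : Finset (Fin 4)) by simp [e])
    have hqt : q ≠ t := fun e => Finset.disjoint_left.mp hdisj
      (show q ∈ ({p, q} : Finset (Fin 4)) by simp) (show q ∈ ({s, t} : Finset (Fin 4)) by simp [e])
    -- `p` has degree two, so `w` has no vertex of degree two
    have hdp : (Finset.univ.filter fun i => p ∈ u i).card = 2 := by
      rw [hdegu p]
      simp [hps, hpt]
    have hdeg2 : ∀ c : Fin 4, ((Finset.univ.image w).filter fun y => c ∈ y).card ≠ 2 := by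
      intro c hc
      exact hclash p c (by rw [hdp, ← hdegeq, hc])
    -- `w` has a pair member (only five members have at most one element)
    have hpair : ∃ x ∈ Finset.univ.image w, x.card = 2 := by
      by_contra hno
      push Not at hno
      have hsub : Finset.univ.image w ⊆
          insert (∅ : Finset (Fin 4)) (Finset.univ.image fun a : Fin 4 => ({a} : Finset (Fin 4))) := by
        intro y hy
        have hy2 := card_le_two_of_mem_lowerFamily _ hlow (by omega) y hy
        have hy1 : y.card ≤ 1 := by have := hno y hy; omega
        rcases Nat.lt_or_ge y.card 1 with h0 | h1'
        · rw [Finset.card_eq_zero.mp (show y.card = 0 by omega)]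
          exact Finset.mem_insert_self _ _
        · obtain ⟨c, rfl⟩ := Finset.card_eq_one.mp (show y.card = 1 by omega)
          exact Finset.mem_insert_of_mem (Finset.mem_image.mpr ⟨c, Finset.mem_univ _, rfl⟩)
      have hle := Finset.card_le_card hsub
      have h5 : (insert (∅ : Finset (Fin 4))
          (Finset.univ.image fun a : Fin 4 => ({a} : Finset (Fin 4)))).card ≤ 5 := by
        refine (Finset.card_insert_le _ _).trans ?_
        rw [Finset.card_image_of_injective _ Finset.singleton_injective, Finset.card_univ,
          Fintype.card_fin]
      rw [hcard] at hle
      omega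
    obtain ⟨a, b, c, hab, hac, hbc, hall⟩ :=
      lowerFamily_seven_no_degree_two _ hlow hcard hpair hdeg2
    -- relabelings
    obtain ⟨π, hπ⟩ := Equiv.Perm.exists_extending_pair (![p, q, s, t] : Fin 4 → Fin 4)
      (![0, 1, 2, 3] : Fin 4 → Fin 4) (vec4_injective p q s t hpq hps hpt hqs hqt hst) (by decide)
    have hπp : π p = 0 := hπ 0
    have hπq : π q = 1 := hπ 1
    have hπs : π s = 2 := hπ 2
    have hπt : π t = 3 := hπ 3
    obtain ⟨π', hπ'⟩ := Equiv.Perm.exists_extending_pair (![a, b, c] : Fin 3 → Fin 4)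
      (![0, 1, 2] : Fin 3 → Fin 4) (vec3_injective a b c hab hac hbc) (by decide)
    have hπa : π' a = 0 := hπ' 0
    have hπb : π' b = 1 := hπ' 1
    have hπc : π' c = 2 := hπ' 2
    refine good_of_ppDerivable_relabel u w _ _ hu hw π π' ?_ ?_ matching_v_triangle_h4_derivable
    · intro i
      have hi : u i ∈ Finset.univ.image u := Finset.mem_image.mpr ⟨i, Finset.mem_univ _, rfl⟩
      rw [himg, Finset.mem_insert, Finset.mem_insert, Finset.mem_insert, Finset.mem_image] at hi
      rcases hi with e | e | e | ⟨x, _, e⟩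
      · rw [e]; exact ⟨5, by simp [Finset.map_insert, hπp, hπq]⟩
      · rw [e]; exact ⟨6, by simp [Finset.map_insert, hπs, hπt]⟩
      · rw [e]; exact ⟨0, by simp⟩
      · rw [← e, Finset.map_singleton]
        exact (by decide : ∀ y : Fin 4, ∃ i' : Fin 7, ({y} : Finset (Fin 4)) =
          (![∅, {0}, {1}, {2}, {3}, {0, 1}, {2, 3}] : Fin 7 → Finset (Fin 4)) i') (π x)
    · intro j
      rcases hall (w j) (Finset.mem_image.mpr ⟨j, Finset.mem_univ _, rfl⟩) with
        e | e | e | e | e | e | e <;> rw [e]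
      · exact ⟨0, by simp⟩
      · exact ⟨1, by simp [hπa]⟩
      · exact ⟨2, by simp [hπb]⟩
      · exact ⟨3, by simp [hπc]⟩
      · exact ⟨4, by simp [Finset.map_insert, hπa, hπb]⟩
      · exact ⟨5, by simp [Finset.map_insert, hπa, hπc]⟩
      · exact ⟨6, by simp [Finset.map_insert, hπb, hπc]⟩
  · -- two edges through a common vertex: degrees 1, 2, 3 occur on the row side
    exfalso
    obtain ⟨v, hv1, hv2⟩ : ∃ v, v ∈ e₁ ∧ v ∈ e₂ := Finset.not_disjoint_iff.mp hdisj
    obtain ⟨q, hq⟩ := Finset.card_eq_one.mp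
      (show (e₁.erase v).card = 1 by rw [Finset.card_erase_of_mem hv1, h1])
    obtain ⟨s, hs⟩ := Finset.card_eq_one.mp
      (show (e₂.erase v).card = 1 by rw [Finset.card_erase_of_mem hv2, h2])
    have hqe : q ∈ e₁.erase v := by rw [hq]; simp
    have hse : s ∈ e₂.erase v := by rw [hs]; simp
    obtain ⟨hqv, hq1⟩ := Finset.mem_erase.mp hqe
    obtain ⟨hsv, hs2⟩ := Finset.mem_erase.mp hse
    have he1 : e₁ = {v, q} := by rw [← Finset.insert_erase hv1, hq]
    have he2 : e₂ = {v, s} := by rw [← Finset.insert_erase hv2, hs]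
    have hqs : q ≠ s := fun e => hne (by rw [he1, he2, e])
    have hq2 : q ∉ e₂ := by
      rw [he2]; simp only [Finset.mem_insert, Finset.mem_singleton, not_or]; exact ⟨hqv, hqs⟩
    -- a fourth coordinate
    obtain ⟨t, ht⟩ : ∃ t : Fin 4, t ∉ ({v, q, s} : Finset (Fin 4)) := by
      by_contra hno
      push Not at hno
      have : (Finset.univ : Finset (Fin 4)) ⊆ {v, q, s} := fun x _ => hno x
      have := Finset.card_le_card this
      rw [Finset.card_univ, Fintype.card_fin] at this
      have h3 : ({v, q, s} : Finset (Fin 4)).card ≤ 3 := Finset.card_le_three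
      omega
    simp only [Finset.mem_insert, Finset.mem_singleton, not_or] at ht
    have ht1 : t ∉ e₁ := by
      rw [he1]; simp only [Finset.mem_insert, Finset.mem_singleton, not_or]; exact ⟨ht.1, ht.2.1⟩
    have ht2 : t ∉ e₂ := by
      rw [he2]; simp only [Finset.mem_insert, Finset.mem_singleton, not_or]; exact ⟨ht.1, ht.2.2⟩
    have hdv : (Finset.univ.filter fun i => v ∈ u i).card = 3 := by rw [hdegu v]; simp [hv1, hv2]
    have hdq : (Finset.univ.filter fun i => q ∈ u i).card = 2 := by rw [hdegu q]; simp [hq1, hq2]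
    have hdt : (Finset.univ.filter fun i => t ∈ u i).card = 1 := by rw [hdegu t]; simp [ht1, ht2]
    -- a vertex of `w` and its degree
    obtain ⟨c, j₀, hc⟩ : ∃ (c : Fin 4) (j : Fin 7), c ∈ w j := by
      by_contra hno
      push Not at hno
      have h01 : w 0 = w 1 := by
        rw [Finset.eq_empty_of_forall_notMem (fun c => hno c 0),
          Finset.eq_empty_of_forall_notMem (fun c => hno c 1)]
      exact absurd (hw h01) (by decide)
    have hd1 : 1 ≤ (Finset.univ.filter fun j => c ∈ w j).card :=
      Finset.card_pos.mpr ⟨j₀, by simp [hc]⟩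
    have hd3 : (Finset.univ.filter fun j => c ∈ w j).card ≤ 3 := by
      have hle := card_filter_mem_le_of_isLowerSet w hw hlw c
      have hsum := Finset.card_filter_add_card_filter_not
        (s := (Finset.univ : Finset (Fin 7))) (fun j => c ∈ w j)
      simp only [Finset.card_univ, Fintype.card_fin] at hsum
      omega
    interval_cases hwc : (Finset.univ.filter fun j => c ∈ w j).card
    · exact hclash t c (by rw [hdt, hwc])
    · exact hclash q c (by rw [hdq, hwc])
    · exact hclash v c (by rw [hdv, hwc])

/-! ## 3. Seven rows -/

/-- **TT for `r ≤ 7` rows, every `h`** (conclusion of item 19152 verbatim for these layouts). -/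
theorem transversalMinorLayouts_nonsingular_of_r_le_seven (h r : ℕ) (hr : r ≤ 7)
    (u w : Fin r → Finset (Fin h)) (hu : Function.Injective u) (hw : Function.Injective w) :
    ∃ H : Matrix (Fin (h + h)) (Fin (h + h)) ℂ, (Matrix.of fun i j : Fin r => (H.submatrix
      (fun a : Fin h => if a ∈ u i then Fin.castAdd h a else Fin.natAdd h a)
      (fun c : Fin h => if c ∈ w j then Fin.natAdd h c else Fin.castAdd h c)).det).det ≠ 0 := by
  classical
  refine tt_rank_le_of_lockedCore 7 (fun h r hr hhr u w hu hw hlu hlw hlk => ?_) h r hr u w hu hw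
  by_cases hr6 : r ≤ 6
  · exact transversalMinorLayouts_nonsingular_of_r_le_six h r hr6 u w hu hw
  have hr7 : r = 7 := by omega
  subst hr7
  by_cases hh : h ≤ 3
  · exact PPSmall.transversalMinorLayouts_nonsingular_of_le_three h 7 hh u w hu hw
  have key : ∀ (u w : Fin 7 → Finset (Fin h)), Function.Injective u → Function.Injective w →
      IsLowerSet (Set.range u) → IsLowerSet (Set.range w) →
      (∀ (a c : Fin h) (β γ : Bool),
        (Finset.univ.filter fun i => (a ∈ u i ↔ β = true)).card ≠
          (Finset.univ.filter fun j => (c ∈ w j ↔ γ = true)).card) →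
      (∀ a : Fin h, ∃ i, a ∈ u i) →
      ∃ H : Matrix (Fin (h + h)) (Fin (h + h)) ℂ, (Matrix.of fun i j : Fin 7 => (H.submatrix
        (fun a : Fin h => if a ∈ u i then Fin.castAdd h a else Fin.natAdd h a)
        (fun c : Fin h => if c ∈ w j then Fin.natAdd h c else Fin.castAdd h c)).det).det ≠ 0 := by
    intro u w hu hw hlu hlw hlk hfull
    have hclash : ∀ (a c : Fin h), (Finset.univ.filter fun i => a ∈ u i).card ≠
        (Finset.univ.filter fun j => c ∈ w j).card := by
      intro a c e
      apply hlk a c true true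
      simp only [iff_true]
      exact e
    by_cases h6 : h = 6
    · subst h6
      have hdu := degree_eq_one_of_claw u hu hlu hfull rfl
      exact good_claw_h6 u w hu hw hlu hlw hfull (fun c hc => hclash 0 c (by rw [hdu, hc]))
    by_cases h5 : h = 5
    · subst h5
      obtain ⟨p, x, hp, hx⟩ := exists_degree_two_one_of_claw_edge u hu hlu hfull rfl (by norm_num)
        (by norm_num)
      exact good_clawEdge_h5 u w hu hw hlu hlw hfull (fun c hc => hclash x c (by rw [hx, hc]))
        (fun c hc => hclash p c (by rw [hp, hc]))
    · have h4 : h = 4 := by omega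
      subst h4
      exact good_twoEdges_h4 u w hu hw hlu hlw hfull hclash
  rcases full_or_full_of_locked u w hlk with hfu | hfw
  · exact key u w hu hw hlu hlw hlk hfu
  · exact tt_layout_swap h 7 u w (key w u hw hu hlw hlu (fun a c β γ e => hlk c a γ β e.symm) hfw)

end Summit.ValiantsHypothesis.ValiantsHypothesis.Theorems.BarrierLever.FiniteCheck
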